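import Mathlib

/-!
# Isotypic modules are `N ⊗ Hom(N, ·)` (the kernel form of MVW chap. 2, Lemma III.3)

Blind cell `pub-hodge-repro2`, seat p8 (gen 5), Tier-5 kernel support.  The record
(route/T5-N3-route-2.md §N3.10.3, the MVW III.5 chain; route/T5-CHECK-N3-p8.md v5 §7 row
N3.10.3) uses Lemma III.3 of [MVW, chap. 2]: the `π₁`-isotypic quotient `S[π₁]` of a smooth
representation `S` of `G₁ × G₂` is of the form `π₁ ⊗ V₂′` with `V₂′` a representation of `G₂`.
This file kernel-checks the module-theoretic content of that statement:

  for a `k`-algebra `R`, a simple `R`-module `N` with `End_R(N) = k` (Schur — supplied by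
  `T5DixmierSchur` for `k = ℂ`), and an `R`-module `T` which is semisimple and isotypic of type
  `N` (every simple submodule is isomorphic to `N`), the evaluation map
      `ev : N ⊗[k] Hom_R(N, T) → T`,  `n ⊗ f ↦ f n`
  is an `R`-linear isomorphism (`ev_bijective`, `evEquiv`), and it intertwines every `R`-linear
  endomorphism `β` of `T` (e.g. the action of an element of `G₂`) with `1 ⊗ β_*`, where `β_*` is
  post-composition on `Hom_R(N, T)` (`ev_postcomp`).  So `T ≅ N ⊗ V₂′` with
  `V₂′ = Hom_R(N, T)` carrying the action of everything that commutes with `R`.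

Route of proof: coordinates — for `T = ι →₀ N`, `Hom_R(N, ι →₀ N) ≃ ι →₀ k` (each coordinate of
`f` is an `R`-endomorphism of `N`, hence a scalar; finitely many are non-zero because `f n₀` has
finite support) — then Mathlib's `TensorProduct.finsuppScalarRight` identifies
`N ⊗[k] (ι →₀ k)` with `ι →₀ N`; the general case transports along Mathlib's
`IsIsotypicOfType.linearEquiv_finsupp` (`T ≃ₗ[R] ι →₀ N`).

What stays prose: that `S[π₁]` is semisimple and `π₁`-isotypic as a `G₁`-module (MVW's
argument through the `K`-invariants and admissibility of `π₁`), the smoothness of `V₂′`, and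
the identification of the objects.

README §8(d): uses an L-value-free non-vanishing device: NO.
-/

noncomputable section

namespace Summit.Ventures.HodgeRepro2.T5IsotypicHom

open TensorProduct

variable {k R N : Type*} [Field k] [Ring R] [Algebra k R] [AddCommGroup N] [Module R N]
  [Module k N] [IsScalarTower k R N]

section Coordinates

variable {ι : Type*}

/-- The `i`-th coordinate of `f : N →ₗ[R] (ι →₀ N)` as an `R`-endomorphism of `N`. -/
def coordEnd (f : N →ₗ[R] (ι →₀ N)) (i : ι) : N →ₗ[R] N := (Finsupp.lapply i) ∘ₗ f

/-- `coordEnd f i n = f n i`. -/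
@[simp] theorem coordEnd_apply (f : N →ₗ[R] (ι →₀ N)) (i : ι) (n : N) :
    coordEnd f i n = f n i := rfl

variable (hSchur : ∀ φ : N →ₗ[R] N, ∃ c : k, ∀ x, φ x = c • x)

/-- The scalar by which the `i`-th coordinate of `f` acts (Schur). -/
noncomputable def coordScalar (f : N →ₗ[R] (ι →₀ N)) (i : ι) : k :=
  Classical.choose (hSchur (coordEnd f i))

omit [Algebra k R] [IsScalarTower k R N] in
/-- `f n i = coordScalar f i • n`. -/
theorem coordScalar_spec (f : N →ₗ[R] (ι →₀ N)) (i : ι) (n : N) :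
    f n i = coordScalar hSchur f i • n :=
  Classical.choose_spec (hSchur (coordEnd f i)) n

omit [Algebra k R] [IsScalarTower k R N] in
/-- The coordinate scalar is determined by its value on one non-zero vector. -/
theorem coordScalar_unique {n₀ : N} (hn₀ : n₀ ≠ 0) {f : N →ₗ[R] (ι →₀ N)} {i : ι} {c : k}
    (h : f n₀ i = c • n₀) : coordScalar hSchur f i = c :=
  smul_left_injective k hn₀ ((coordScalar_spec hSchur f i n₀).symm.trans h)

omit [Algebra k R] [IsScalarTower k R N] in
/-- Only finitely many coordinate scalars are non-zero (`f n₀` has finite support). -/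
theorem support_coordScalar_finite [Nontrivial N] (f : N →ₗ[R] (ι →₀ N)) :
    (Function.support (coordScalar hSchur f)).Finite := by
  obtain ⟨n₀, hn₀⟩ := exists_ne (0 : N)
  refine (f n₀).support.finite_toSet.subset ?_
  intro i hi
  rw [Function.mem_support] at hi
  rw [Finset.mem_coe, Finsupp.mem_support_iff, coordScalar_spec hSchur f i n₀]
  exact smul_ne_zero hi hn₀

/-- The coordinates of `f` as a finitely supported function. -/
noncomputable def coord [Nontrivial N] (f : N →ₗ[R] (ι →₀ N)) : ι →₀ k :=
  Finsupp.ofSupportFinite (coordScalar hSchur f) (support_coordScalar_finite hSchur f)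

omit [Algebra k R] [IsScalarTower k R N] in
/-- `coord f i = coordScalar f i`. -/
@[simp] theorem coord_apply [Nontrivial N] (f : N →ₗ[R] (ι →₀ N)) (i : ι) :
    coord hSchur f i = coordScalar hSchur f i := rfl

omit hSchur in
/-- From coordinates `g : ι →₀ k` to the `R`-linear map `n ↦ Σ_i g i • n` (as a finsupp). -/
def ofCoord (g : ι →₀ k) : N →ₗ[R] (ι →₀ N) where
  toFun n := g.mapRange (· • n) (zero_smul k n)
  map_add' n n' := by
    ext i
    simp [smul_add]
  map_smul' r n := by
    ext i
    simp [smul_comm (g i) r n]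

omit hSchur in
/-- `ofCoord g n i = g i • n`. -/
@[simp] theorem ofCoord_apply (g : ι →₀ k) (n : N) (i : ι) : ofCoord (R := R) g n i = g i • n := by
  simp [ofCoord]

/-- `coord ∘ ofCoord = id`. -/
theorem coord_ofCoord [Nontrivial N] (g : ι →₀ k) : coord hSchur (ofCoord (R := R) g) = g := by
  obtain ⟨n₀, hn₀⟩ := exists_ne (0 : N)
  ext i
  rw [coord_apply]
  exact coordScalar_unique hSchur hn₀ (ofCoord_apply g n₀ i)

/-- `ofCoord ∘ coord = id`. -/
theorem ofCoord_coord [Nontrivial N] (f : N →ₗ[R] (ι →₀ N)) : ofCoord (coord hSchur f) = f := by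
  ext n i
  rw [ofCoord_apply (R := R) (coord hSchur f) n i, coord_apply, coordScalar_spec hSchur f i n]

/-- **Coordinates.** Under Schur for `N`, `Hom_R(N, ι →₀ N) ≃ ι →₀ k` as `k`-vector spaces. -/
noncomputable def coordEquiv [Nontrivial N] : (N →ₗ[R] (ι →₀ N)) ≃ₗ[k] (ι →₀ k) where
  toFun := coord hSchur
  invFun := ofCoord
  left_inv := ofCoord_coord hSchur
  right_inv := coord_ofCoord hSchur
  map_add' f g := by
    obtain ⟨n₀, hn₀⟩ := exists_ne (0 : N)
    ext i
    rw [Finsupp.add_apply, coord_apply, coord_apply, coord_apply]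
    apply coordScalar_unique hSchur hn₀
    rw [LinearMap.add_apply, Finsupp.add_apply, coordScalar_spec hSchur f,
      coordScalar_spec hSchur g, add_smul]
  map_smul' c f := by
    obtain ⟨n₀, hn₀⟩ := exists_ne (0 : N)
    ext i
    rw [RingHom.id_apply, Finsupp.smul_apply, coord_apply, coord_apply, smul_eq_mul]
    apply coordScalar_unique hSchur hn₀
    rw [LinearMap.smul_apply, Finsupp.smul_apply, coordScalar_spec hSchur f, smul_smul]

/-- `coordEquiv f = coord f`. -/
@[simp] theorem coordEquiv_apply [Nontrivial N] (f : N →ₗ[R] (ι →₀ N)) :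
    coordEquiv hSchur f = coord hSchur f := rfl

end Coordinates

section Eval

variable (k R N) (T : Type*) [AddCommGroup T] [Module R T] [Module k T] [IsScalarTower k R T]

/-- Evaluation at `n`, as a `k`-linear map `Hom_R(N, T) → T`. -/
def evalAt (n : N) : (N →ₗ[R] T) →ₗ[k] T where
  toFun f := f n
  map_add' _ _ := rfl
  map_smul' _ _ := rfl

omit [Module k N] [IsScalarTower k R N] in
/-- `evalAt n f = f n`. -/
@[simp] theorem evalAt_apply (n : N) (f : N →ₗ[R] T) : evalAt k R N T n f = f n := rfl

/-- `n ↦ evalAt n` is `R`-linear. -/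
def evalBilin : N →ₗ[R] ((N →ₗ[R] T) →ₗ[k] T) where
  toFun := evalAt k R N T
  map_add' n n' := by
    ext f
    simp only [evalAt_apply, LinearMap.add_apply, map_add]
  map_smul' r n := by
    ext f
    simp only [evalAt_apply, LinearMap.smul_apply, map_smul, RingHom.id_apply]

/-- **The evaluation map** `ev : N ⊗[k] Hom_R(N, T) → T`, `n ⊗ f ↦ f n`, `R`-linear for the
action of `R` through `N`. -/
def ev : N ⊗[k] (N →ₗ[R] T) →ₗ[R] T :=
  TensorProduct.AlgebraTensorModule.lift (evalBilin k R N T)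

/-- `ev (n ⊗ f) = f n`. -/
@[simp] theorem ev_tmul (n : N) (f : N →ₗ[R] T) : ev k R N T (n ⊗ₜ[k] f) = f n := rfl

/-- Post-composition with an `R`-linear endomorphism `β` of `T`, as a `k`-linear endomorphism of
`Hom_R(N, T)` (the action of `G₂` on `V₂′ = Hom_{G₁}(π₁, S[π₁])`). -/
def postcomp (β : T →ₗ[R] T) : (N →ₗ[R] T) →ₗ[k] (N →ₗ[R] T) where
  toFun f := β ∘ₗ f
  map_add' f g := by
    ext n
    simp only [LinearMap.comp_apply, LinearMap.add_apply, map_add]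
  map_smul' c f := by
    ext n
    simp only [LinearMap.comp_apply, LinearMap.smul_apply, RingHom.id_apply,
      LinearMap.map_smul_of_tower]

omit [Module k N] [IsScalarTower k R N] in
/-- `postcomp β f n = β (f n)`. -/
@[simp] theorem postcomp_apply (β : T →ₗ[R] T) (f : N →ₗ[R] T) (n : N) :
    postcomp k R N T β f n = β (f n) := rfl

/-- **Equivariance of `ev`.** `ev` intertwines `1 ⊗ β_*` with `β`. -/
theorem ev_postcomp (β : T →ₗ[R] T) (x : N ⊗[k] (N →ₗ[R] T)) :
    ev k R N T (TensorProduct.map LinearMap.id (postcomp k R N T β) x) = β (ev k R N T x) := by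
  induction x using TensorProduct.induction_on with
  | zero => simp only [map_zero]
  | tmul n f => simp only [TensorProduct.map_tmul, LinearMap.id_apply, ev_tmul, postcomp_apply]
  | add x y hx hy => simp only [map_add, hx, hy]

end Eval

section Finsupp

variable {ι : Type*} [DecidableEq ι] [Nontrivial N]

/-- For `T = ι →₀ N`, `ev` is `finsuppScalarRight ∘ (1 ⊗ coordEquiv)`. -/
theorem ev_finsupp_eq (hSchur : ∀ φ : N →ₗ[R] N, ∃ c : k, ∀ x, φ x = c • x)
    (x : N ⊗[k] (N →ₗ[R] (ι →₀ N))) :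
    ev k R N (ι →₀ N) x = finsuppScalarRight k R N ι
      (TensorProduct.congr (LinearEquiv.refl k N) (coordEquiv hSchur) x) := by
  induction x using TensorProduct.induction_on with
  | zero => simp only [map_zero]
  | tmul n f =>
    ext i
    rw [ev_tmul, TensorProduct.congr_tmul, LinearEquiv.refl_apply,
      finsuppScalarRight_apply_tmul_apply, coordEquiv_apply, coord_apply,
      coordScalar_spec hSchur f i n]
  | add x y hx hy => simp only [map_add, hx, hy]

/-- For `T = ι →₀ N`, `ev` is bijective. -/
theorem ev_finsupp_bijective (hSchur : ∀ φ : N →ₗ[R] N, ∃ c : k, ∀ x, φ x = c • x) :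
    Function.Bijective (ev k R N (ι →₀ N)) := by
  have h : (ev k R N (ι →₀ N) : N ⊗[k] (N →ₗ[R] (ι →₀ N)) → (ι →₀ N)) =
      (finsuppScalarRight k R N ι) ∘
        (TensorProduct.congr (LinearEquiv.refl k N) (coordEquiv hSchur)) :=
    funext (ev_finsupp_eq hSchur)
  rw [h]
  exact (finsuppScalarRight k R N ι).bijective.comp
    (TensorProduct.congr (LinearEquiv.refl k N) (coordEquiv hSchur)).bijective

end Finsupp

section Transport

variable (k) {T T' : Type*} [AddCommGroup T] [Module R T] [Module k T] [IsScalarTower k R T]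
  [AddCommGroup T'] [Module R T'] [Module k T'] [IsScalarTower k R T']

/-- Post-composition with an `R`-linear equivalence `T ≃ T'` on `Hom_R(N, ·)`. -/
def homCongr (e : T ≃ₗ[R] T') : (N →ₗ[R] T) ≃ₗ[k] (N →ₗ[R] T') where
  toFun f := e.toLinearMap ∘ₗ f
  invFun g := e.symm.toLinearMap ∘ₗ g
  left_inv f := by
    ext n
    simp only [LinearMap.comp_apply, LinearEquiv.coe_coe, LinearEquiv.symm_apply_apply]
  right_inv g := by
    ext n
    simp only [LinearMap.comp_apply, LinearEquiv.coe_coe, LinearEquiv.apply_symm_apply]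
  map_add' f g := by
    ext n
    simp only [LinearMap.comp_apply, LinearMap.add_apply, LinearEquiv.coe_coe, map_add]
  map_smul' c f := by
    ext n
    simp only [LinearMap.comp_apply, LinearMap.smul_apply, LinearEquiv.coe_coe, RingHom.id_apply]
    exact LinearMap.map_smul_of_tower (e : T →ₗ[R] T') c (f n)

omit [Module k N] [IsScalarTower k R N] in
/-- `homCongr e f n = e (f n)`. -/
@[simp] theorem homCongr_apply (e : T ≃ₗ[R] T') (f : N →ₗ[R] T) (n : N) :
    homCongr k e f n = e (f n) := rfl

/-- `ev` is natural in `T`: `e ∘ ev_T = ev_{T'} ∘ (1 ⊗ homCongr e)`. -/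
theorem ev_congr (e : T ≃ₗ[R] T') (x : N ⊗[k] (N →ₗ[R] T)) :
    e (ev k R N T x) = ev k R N T' (TensorProduct.congr (LinearEquiv.refl k N) (homCongr k e) x) := by
  induction x using TensorProduct.induction_on with
  | zero => simp only [map_zero]
  | tmul n f =>
    simp only [ev_tmul, TensorProduct.congr_tmul, LinearEquiv.refl_apply, homCongr_apply]
  | add x y hx hy => simp only [map_add, hx, hy]

/-- Bijectivity of `ev` transports along `T ≃ₗ[R] T'`. -/
theorem ev_bijective_of_linearEquiv (e : T ≃ₗ[R] T') (h : Function.Bijective (ev k R N T')) :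
    Function.Bijective (ev k R N T) := by
  have hcomp : (e : T → T') ∘ (ev k R N T) = (ev k R N T') ∘
      (TensorProduct.congr (LinearEquiv.refl k N) (homCongr k e)) :=
    funext (ev_congr k e)
  have h2 : Function.Bijective ((e : T → T') ∘ (ev k R N T)) := by
    rw [hcomp]
    exact h.comp (TensorProduct.congr (LinearEquiv.refl k N) (homCongr k e)).bijective
  refine ⟨fun x y hxy => h2.1 ?_, fun t => ?_⟩
  · simp only [Function.comp_apply, hxy]
  · obtain ⟨x, hx⟩ := h2.2 (e t)
    exact ⟨x, e.injective hx⟩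

end Transport

section Isotypic

universe u

variable [Nontrivial N] {T : Type u} [AddCommGroup T] [Module R T] [Module k T]
  [IsScalarTower k R T]

/-- **MVW III.3, kernel form.** If `T` is semisimple and isotypic of type `N` (every simple
submodule of `T` is isomorphic to `N`) and `End_R(N) = k`, the evaluation map
`N ⊗[k] Hom_R(N, T) → T` is bijective. -/
theorem ev_bijective (hSchur : ∀ φ : N →ₗ[R] N, ∃ c : k, ∀ x, φ x = c • x)
    [IsSemisimpleModule R T] (hT : IsIsotypicOfType R T N) :
    Function.Bijective (ev k R N T) := by
  obtain ⟨ι, ⟨e⟩⟩ := hT.linearEquiv_finsupp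
  classical
  exact ev_bijective_of_linearEquiv k e (ev_finsupp_bijective hSchur)

/-- **MVW III.3, kernel form (equivalence).** `N ⊗[k] Hom_R(N, T) ≃ₗ[R] T`, given by `ev`. -/
def evEquiv (hSchur : ∀ φ : N →ₗ[R] N, ∃ c : k, ∀ x, φ x = c • x) [IsSemisimpleModule R T]
    (hT : IsIsotypicOfType R T N) :
    N ⊗[k] (N →ₗ[R] T) ≃ₗ[R] T :=
  LinearEquiv.ofBijective (ev k R N T) (ev_bijective hSchur hT)

/-- `evEquiv (n ⊗ f) = f n`. -/
@[simp] theorem evEquiv_tmul (hSchur : ∀ φ : N →ₗ[R] N, ∃ c : k, ∀ x, φ x = c • x)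
    [IsSemisimpleModule R T] (hT : IsIsotypicOfType R T N) (n : N) (f : N →ₗ[R] T) :
    evEquiv hSchur hT (n ⊗ₜ[k] f) = f n := rfl

/-- **Equivariance, packaged.** For a group `G₂` acting on `T` by `R`-linear maps
(`ρ : G₂ → T →ₗ[R] T`), `evEquiv` intertwines `1 ⊗ ρ(g)_*` on `N ⊗ Hom_R(N, T)` with `ρ g` on `T`:
`T ≅ N ⊗ V₂′` as `(R, G₂)`-modules with `V₂′ = Hom_R(N, T)`, `G₂` acting by post-composition. -/
theorem evEquiv_postcomp (hSchur : ∀ φ : N →ₗ[R] N, ∃ c : k, ∀ x, φ x = c • x)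
    [IsSemisimpleModule R T] (hT : IsIsotypicOfType R T N) {G₂ : Type*}
    (ρ : G₂ → T →ₗ[R] T) (g : G₂) (x : N ⊗[k] (N →ₗ[R] T)) :
    evEquiv hSchur hT (TensorProduct.map LinearMap.id (postcomp k R N T (ρ g)) x) =
      ρ g (evEquiv hSchur hT x) :=
  ev_postcomp k R N T (ρ g) x

end Isotypic

end Summit.Ventures.HodgeRepro2.T5IsotypicHom

end
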